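import Summits.CriticalPhenomena.PercolationContinuityZ3.Theorems.PercNearOneGluingNoHeavyPcintVdBEStepObjects
import HarnessLib

/-!
# PCINT lane, king route, K1 step (3b): per-state domination, the generic step (`c ≠ o`)

Cell `prim-pcint`, seat `prim-pcint-1` (gen 10); memo `run/shared/lean/prim/pcint/KING-ROUTE.md` §K1 (3).

For a step context `X` with an examiner `d` of `c` (`X.DCtx`, `…PcintVdBEFibreFactor.lean`) and a step test function `g`
of the children of `b₂`, the `u`-integral of the factorised fibre dominates (`StepCtx.DCtx.inner_dominance`):

  `(Σ_u pw u · Ψ-factor(u, w)) · E_{π_q}[g] ≤ Σ_u pw u · Ψ-factor(u, w) · K u`,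

where the `Ψ`-factor `A(u b₂, u c) · D(u c) · Sc(u c) · ∏_{failed b} Fb(u b, u c)` is the indicator of the fibre condition
of `fib_mixG_iff` (`DCtx.ind_PsiA`).  Proof: both sides are computed by `AdaptDom.inner_sum_eq`; the brother factors
regroup into the table's slot factors at the two brother positions (`DCtx.sf_prod_eq`); the law of the reads is the
table's children law (`sum_reads_eq_cps`); and `VdBELocal.dominance_checkCD` at the geometry
`(pos c - pos b₂, pos d - pos b₂) ∈ geoms`, `ε(d) = w d`, is the claim up to the positive factor `10³⁰ · Z`.
-/

namespace Summit.CriticalPhenomena.PercolationContinuityZ3.Theorems.Pcint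

namespace VdBEMarkov

open Finset AdaptDom ClusterExpl VdBEProcess VdBELocal Literature.Probability.LatticeModels

variable {Λ : Finset (Site 2)} {enc : ↥Λ → ℕ} {o : ↥Λ}

namespace StepCtx

variable (X : StepCtx enc o)

/-! ### The factors of the fibre condition -/

/-- The `(b₂, c)` factor `[η(b₂, c)(α, γ)]`. -/
noncomputable def Aα (α γ : PState) : ℝ := if etaB X.b₂.1 X.c.1 α γ = true then 1 else 0

/-- The successful-brother indicator. -/
noncomputable def Sc (w : ↥Λ → PState) (γ : PState) : ℝ :=
  if (∀ b ∈ X.B, b ≠ X.b₂ → X.σ b = some true → etaB b.1 X.c.1 (w b) γ = true) then 1 else 0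

variable {X} (D : X.DCtx)

/-- The `(c, d)` factor `[η(c, d)(γ, w d)]`. -/
noncomputable def DCtx.Dd (w : ↥Λ → PState) (γ : PState) : ℝ := if etaB X.c.1 D.d.1 γ (w D.d) = true then 1 else 0

/-- **The fibre condition of `fib_mixG_iff`** (case `c ≠ o`), as a predicate (of this file, not a cited fact). -/
def DCtx.PsiA (u w : ↥Λ → PState) : Prop :=
  etaB X.b₂.1 X.c.1 (u X.b₂) (u X.c) = true ∧ etaB X.c.1 D.d.1 (u X.c) (w D.d) = true ∧
    (∀ b ∈ X.B, X.σ b = some false → etaB b.1 X.c.1 (u b) (u X.c) = false) ∧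
    (∀ b ∈ X.B, b ≠ X.b₂ → X.σ b = some true → etaB b.1 X.c.1 (w b) (u X.c) = true)

/-- The fibre factorisation with `PsiA`. -/
theorem DCtx.fib_mixG_iff' (u w : ↥Λ → PState) : Fib enc o X.n X.σ (mixG X.W₀ u w) ↔ X.FibRest w ∧ D.PsiA u w :=
  D.fib_mixG_iff u w

/-- **The indicator of `PsiA` is the product of the four factors.** -/
theorem DCtx.ind_PsiA (u w : ↥Λ → PState) [Decidable (D.PsiA u w)] :
    (if D.PsiA u w then (1 : ℝ) else 0) =
      X.Aα (u X.b₂) (u X.c) * D.Dd w (u X.c) * X.Sc w (u X.c) * ∏ b ∈ X.Bf, X.Fb b (u b) (u X.c) := by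
  by_cases hΨ : D.PsiA u w
  · rw [if_pos hΨ]
    obtain ⟨h1, h2, h3, h4⟩ := hΨ
    rw [Aα, if_pos h1, DCtx.Dd, if_pos h2, Sc, if_pos h4, Finset.prod_eq_one (fun b hb => ?_)]
    · ring
    · simp only [Fb]; rw [if_pos (h3 b (X.mem_Bf hb).1 (X.mem_Bf hb).2.1)]
  · rw [if_neg hΨ]
    unfold DCtx.PsiA at hΨ
    by_cases h1 : etaB X.b₂.1 X.c.1 (u X.b₂) (u X.c) = true
    · by_cases h2 : etaB X.c.1 D.d.1 (u X.c) (w D.d) = true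
      · by_cases h4 : (∀ b ∈ X.B, b ≠ X.b₂ → X.σ b = some true → etaB b.1 X.c.1 (w b) (u X.c) = true)
        · have h3 : ¬ (∀ b ∈ X.B, X.σ b = some false → etaB b.1 X.c.1 (u b) (u X.c) = false) :=
            fun h3 => hΨ ⟨h1, h2, h3, h4⟩
          push Not at h3
          obtain ⟨b, hbB, hσ, hne⟩ := h3
          have hbf : b ∈ X.Bf := mem_filter.2 ⟨hbB, hσ⟩
          rw [Finset.prod_eq_zero hbf (by simp only [Fb]; rw [if_neg hne])]
          ring
        · rw [Sc, if_neg h4]; ring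
      · rw [DCtx.Dd, if_neg h2]; ring
    · rw [Aα, if_neg h1]; ring

/-! ### The examiner `d` and the brother positions -/

/-- The offset of `d` from `b₂`. -/
def DCtx.dp : Pos := pos D.d.1 - pos X.b₂.1

/-- `d` is not one of the sites examined by `c` (it was revealed earlier). -/
theorem DCtx.d_not_mem_B : D.d ∉ X.B := fun h => by
  have h1 := (X.mem_B h).1
  have h2 : traj enc o X.σ D.k₁ D.d = some true := (sel_revealedTrue (boxGraph Λ) enc D.hseld).1
  have h3 : traj enc o X.σ X.k₀ D.d = traj enc o X.σ D.k₁ D.d :=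
    run_apply_of_ne_none (rule_unrevealed (boxGraph Λ) enc o) (readOut X.σ)
      (show traj enc o X.σ D.k₁ D.d ≠ none by rw [h2]; simp) X.k₀ D.hk₁.le
  rw [h1, h2] at h3; exact absurd h3 (by simp)

/-- `d ≠ b₂`. -/
theorem DCtx.d_ne_b₂ : D.d ≠ X.b₂ := fun h => D.d_not_mem_W₀ (X.mem_W₀.2 (Or.inl h))

/-- **The geometry of the step is one of the twelve of the table.** -/
theorem DCtx.geom_mem : (X.cp, D.dp) ∈ geoms := by
  rw [mem_geoms_iff]
  refine ⟨X.cp_mem, ?_, fun h => D.d_ne_b₂ ?_⟩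
  · rw [mem_nbrs_iff_sub]
    have := sub_mem_nbrs0_of_adj D.adj_d_c.symm
    have e : D.dp - X.cp = pos D.d.1 - pos X.c.1 := by simp only [DCtx.dp, cp]; abel
    rw [e]; exact this
  · have : pos D.d.1 = pos X.b₂.1 := sub_eq_zero.1 h
    exact Subtype.ext (pos_injective this)

/-- The two brother offsets (the neighbours of `c` other than `b₂` and `d`), in the table's order. -/
def DCtx.π (i : ℕ) : Pos := ((nbrs X.cp).filter fun b => b ≠ (0, 0) ∧ b ≠ D.dp).getD i (0, 0)

/-- The brother offset list is `[π 0, π 1]`. -/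
theorem DCtx.brL_eq : ((nbrs X.cp).filter fun b => b ≠ (0, 0) ∧ b ≠ D.dp) = [D.π 0, D.π 1] :=
  list_eq_two (brothers_spec D.geom_mem).1

/-- The brother offsets are neighbours of `cp` other than `0` and `dp`. -/
theorem DCtx.π_spec {i : ℕ} (hi : i < 2) : D.π i ∈ nbrs X.cp ∧ D.π i ≠ (0, 0) ∧ D.π i ≠ D.dp := by
  have h : D.π i ∈ ((nbrs X.cp).filter fun b => b ≠ (0, 0) ∧ b ≠ D.dp) := by
    rw [D.brL_eq]; interval_cases i <;> simp
  rw [List.mem_filter] at h; simpa using h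

/-- The brother offsets are distinct. -/
theorem DCtx.π_ne : D.π 0 ≠ D.π 1 := by
  have h := (brothers_spec D.geom_mem).2
  rw [D.brL_eq] at h
  exact ne_of_nodup_two h

/-- The optional site at the `i`-th brother position. -/
noncomputable def DCtx.ob (i : ℕ) : Option ↥Λ := siteAt Λ (pos X.b₂.1 + D.π i)

/-- The position of a brother site. -/
theorem DCtx.ob_pos (i : ℕ) : ∀ b, D.ob i = some b → pos b.1 = pos X.b₂.1 + D.π i :=
  fun _ h => siteAt_eq_some_iff.1 h

/-- The relative position of a brother site. -/
theorem DCtx.ob_sub (i : ℕ) : ∀ b, D.ob i = some b → pos b.1 - pos X.b₂.1 = D.π i :=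
  fun b h => by rw [D.ob_pos i b h, add_sub_cancel_left]

/-- A brother site is not `b₂`. -/
theorem DCtx.ob_ne_b₂ {i : ℕ} (hi : i < 2) : ∀ b, D.ob i = some b → b ≠ X.b₂ := fun b h hb => by
  have := D.ob_sub i b h
  rw [hb, pos_sub_self] at this
  exact (D.π_spec hi).2.1 this.symm

/-- The brother sites are distinct. -/
theorem DCtx.ob_distinct : ∀ v, D.ob 0 = some v → D.ob 1 ≠ some v :=
  fun v hv => siteAt_ne_of_ne (fun h => D.π_ne (add_left_cancel h)) v hv

/-- **Every site examined by `c`, other than `b₂`, sits at a brother position.** -/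
theorem DCtx.ob_cover {b : ↥Λ} (hb : b ∈ X.B) (hne : b ≠ X.b₂) : D.ob 0 = some b ∨ D.ob 1 = some b := by
  have hρ : pos b.1 - pos X.b₂.1 ∈ ((nbrs X.cp).filter fun b => b ≠ (0, 0) ∧ b ≠ D.dp) := by
    rw [List.mem_filter]
    refine ⟨?_, ?_⟩
    · rw [mem_nbrs_iff_sub]
      have := sub_mem_nbrs0_of_adj (X.mem_B hb).2
      have e : pos b.1 - pos X.b₂.1 - X.cp = pos b.1 - pos X.c.1 := by simp only [cp]; abel
      rw [e]; exact this
    · simp only [ne_eq, decide_eq_true_eq]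
      refine ⟨fun h => hne (Subtype.ext (pos_injective (sub_eq_zero.1 h))), fun h => D.d_not_mem_B ?_⟩
      have : pos b.1 = pos D.d.1 := sub_left_injective h
      rw [show b = D.d from Subtype.ext (pos_injective this)] at hb; exact hb
  rw [D.brL_eq] at hρ
  simp only [List.mem_cons, List.mem_nil_iff, or_false] at hρ
  have key : ∀ i, pos b.1 - pos X.b₂.1 = D.π i → D.ob i = some b := fun i hi => by
    unfold DCtx.ob; rw [← hi, add_sub_cancel]; exact siteAt_pos b
  rcases hρ with h | h
  · exact Or.inl (key 0 h)
  · exact Or.inr (key 1 h)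

/-- The normalisation of the two slot factors. -/
noncomputable def DCtx.Z (w : ↥Λ → PState) : ℝ := normS (X.slotOf w (D.ob 0)) * normS (X.slotOf w (D.ob 1))

/-- `Z > 0`. -/
theorem DCtx.Z_pos (w : ↥Λ → PState) : 0 < D.Z w := mul_pos (normS_pos _) (normS_pos _)

/-- The successful-brother indicator regrouped over the two brother positions. -/
theorem DCtx.Sc_eq (w : ↥Λ → PState) (γ : PState) : X.Sc w γ = X.optP w γ (D.ob 0) * X.optP w γ (D.ob 1) := by
  unfold Sc optP
  rw [← ind_and]
  have h : (∀ b ∈ X.B, b ≠ X.b₂ → X.σ b = some true → etaB b.1 X.c.1 (w b) γ = true) ↔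
      (∀ b ∈ X.Bs, etaB b.1 X.c.1 (w b) γ = true) := by
    simp only [Bs, mem_filter, and_imp]
  exact if_congr (h.trans (forall_iff_opt_two _ (D.ob 0) (D.ob 1)
    (fun b hb => D.ob_cover (mem_filter.1 hb).1 (mem_filter.1 hb).2.1))) rfl rfl

/-- **The brother factors are the table's slot factors** (up to the normalisation `Z`). -/
theorem DCtx.sf_prod_eq (w : ↥Λ → PState) (γ : PState) :
    (slotFactor X.cp (D.π 0) γ (X.slotOf w (D.ob 0)) : ℝ) * (slotFactor X.cp (D.π 1) γ (X.slotOf w (D.ob 1)) : ℝ) =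
      D.Z w * (X.Sc w γ * ∏ b ∈ X.Bf, X.fb γ b) := by
  rw [X.slot_cast w γ (show pos X.c.1 - pos X.b₂.1 = X.cp from rfl) (D.ob_sub 0) (D.ob_ne_b₂ (by norm_num)),
    X.slot_cast w γ (show pos X.c.1 - pos X.b₂.1 = X.cp from rfl) (D.ob_sub 1) (D.ob_ne_b₂ (by norm_num)),
    prod_eq_optF_two (X.fb γ) (D.ob 0) (D.ob 1) D.ob_distinct
      (fun b hb => D.ob_cover (X.mem_Bf hb).1 (X.mem_Bf hb).2.2.1),
    D.Sc_eq w γ]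
  unfold DCtx.Z; ring

/-! ### The per-state domination inequality -/

/-- The weight of the pair `(α, γ)` of states of `(b₂, c)` in the fibre, given `w`. -/
noncomputable def DCtx.Φ (w : ↥Λ → PState) (α γ : PState) : ℝ :=
  mP α * mP γ * X.Aα α γ * D.Dd w γ * X.Sc w γ * ∏ b ∈ X.Bf, X.fb γ b

/-- **The table's law vector, unfolded**: at the geometry of the step, with `ε(d) = w d` and the slots of the two brother
positions, `lawN` is `10³⁰ · Z · Σ_{α,γ} Φ α γ · ∏_j cps_j(α, y_j)`. -/
theorem DCtx.lawN_cast (w : ↥Λ → PState) (y : Bool × Bool × Bool) :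
    (lawN (0, 0) X.cp (fun γ => if eta X.cp D.dp γ (w D.d) then 1 else 0)
        ((nbrs X.cp).filter fun b => b ≠ (0, 0) ∧ b ≠ D.dp) [X.slotOf w (D.ob 0), X.slotOf w (D.ob 1)]
        ((nbrs (0, 0)).filter fun a => a ≠ X.cp) (toL y) : ℝ) =
      10 ^ 30 * D.Z w * ∑ α, ∑ γ, D.Φ w α γ * (X.cps 0 α y.1 * X.cps 1 α y.2.1 * X.cps 2 α y.2.2) := by
  have hch : ((nbrs (0, 0)).filter fun a => a ≠ X.cp) = [X.δ 0, X.δ 1, X.δ 2] := X.chL_eq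
  rw [D.brL_eq, hch]
  simp only [toL]
  rw [lawN_two_three]
  push_cast
  rw [Finset.mul_sum]
  refine Finset.sum_congr rfl fun α _ => ?_
  rw [Finset.mul_sum]
  refine Finset.sum_congr rfl fun γ _ => ?_
  have hA : (if eta (0, 0) X.cp α γ then (1 : ℝ) else 0) = X.Aα α γ := by
    simp only [Aα, etaB_eq_eta_sub X.b₂.1 X.c.1 (pos X.b₂.1), pos_sub_self]; rfl
  have hD : (if eta X.cp D.dp γ (w D.d) then (1 : ℝ) else 0) = D.Dd w γ := by
    simp only [DCtx.Dd, etaB_eq_eta_sub X.c.1 D.d.1 (pos X.b₂.1)]; rfl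
  rw [priorN_cast, priorN_cast, hA, hD, D.sf_prod_eq w γ, childProb_cast, childProb_cast, childProb_cast]
  simp only [DCtx.Φ, cps]
  ring

/-- **Per-state domination, generic step.**  For every `w`, the `u`-integral of the fibre factor times the payoff
dominates `E_{π_q}[g]` times the `u`-integral of the fibre factor. -/
theorem DCtx.inner_dominance {g : (↥Λ → Bool) → ℝ} (hg : StepTest X.C g) (w : ↥Λ → PState) :
    (∑ u, pw X.mPV u * (X.Aα (u X.b₂) (u X.c) * D.Dd w (u X.c) * X.Sc w (u X.c) *
        ∏ b ∈ X.Bf, X.Fb b (u b) (u X.c))) * (∑ ω : ↥Λ → Bool, wt (556 / 1000) ω * g ω) ≤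
      ∑ u, pw X.mPV u * (X.Aα (u X.b₂) (u X.c) * D.Dd w (u X.c) * X.Sc w (u X.c) *
        (∏ b ∈ X.Bf, X.Fb b (u b) (u X.c)) * X.K g u) := by
  obtain ⟨h01, h02, h12⟩ := X.oc_distinct
  have hb₂ : X.b₂ ∉ X.Bf := fun h => (X.mem_Bf h).2.2.1 rfl
  have hc : X.c ∉ X.Bf := fun h => (X.mem_Bf h).2.2.2.1 rfl
  -- the mass
  have eM : ∑ u, pw X.mPV u * (X.Aα (u X.b₂) (u X.c) * D.Dd w (u X.c) * X.Sc w (u X.c) *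
      ∏ b ∈ X.Bf, X.Fb b (u b) (u X.c)) = ∑ α, ∑ γ, D.Φ w α γ := by
    have h := inner_sum_eq X.mPV X.mPV_sum X.b₂ X.c X.b₂_ne_c.symm X.Bf hb₂ hc (X.oc 0) (X.oc 1) (X.oc 2) h01 h02 h12
      X.oc_hoW X.Aα (D.Dd w) (X.Sc w) X.Fb X.φ (fun _ _ _ => (1 : ℝ))
    simp only [mul_one] at h
    rw [h]
    refine Finset.sum_congr rfl fun α _ => Finset.sum_congr rfl fun γ _ => ?_
    rw [X.sum_lawB_prod α, mul_one]
    rfl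
  -- the payoff side
  have eR : ∑ u, pw X.mPV u * (X.Aα (u X.b₂) (u X.c) * D.Dd w (u X.c) * X.Sc w (u X.c) *
      (∏ b ∈ X.Bf, X.Fb b (u b) (u X.c)) * X.K g u) =
      ∑ α, ∑ γ, D.Φ w α γ * ∑ y0, ∑ y1, ∑ y2, X.cps 0 α y0 * X.cps 1 α y1 * X.cps 2 α y2 * X.Gt g y0 y1 y2 := by
    have e1 : ∀ u, pw X.mPV u * (X.Aα (u X.b₂) (u X.c) * D.Dd w (u X.c) * X.Sc w (u X.c) *
        (∏ b ∈ X.Bf, X.Fb b (u b) (u X.c)) * X.K g u) =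
        pw X.mPV u * (X.Aα (u X.b₂) (u X.c) * D.Dd w (u X.c) * X.Sc w (u X.c) *
        (∏ b ∈ X.Bf, X.Fb b (u b) (u X.c)) * X.Gt g (readB (X.φ (u X.b₂)) (X.oc 0) u)
          (readB (X.φ (u X.b₂)) (X.oc 1) u) (readB (X.φ (u X.b₂)) (X.oc 2) u)) := fun u => by
      rw [X.K_eq_Gt hg u]
    rw [Finset.sum_congr rfl fun u _ => e1 u,
      inner_sum_eq X.mPV X.mPV_sum X.b₂ X.c X.b₂_ne_c.symm X.Bf hb₂ hc (X.oc 0) (X.oc 1) (X.oc 2) h01 h02 h12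
        X.oc_hoW X.Aα (D.Dd w) (X.Sc w) X.Fb X.φ (X.Gt g)]
    refine Finset.sum_congr rfl fun α _ => Finset.sum_congr rfl fun γ _ => ?_
    rw [X.sum_reads_eq_cps g α]
    rfl
  rw [eM, eR, X.E_eq hg]
  -- the table
  have tab := dominance_checkCD D.geom_mem (w D.d) (X.slotOf w (D.ob 0)) (X.slotOf w (D.ob 1))
    (fun y => X.Gt g y.1 y.2.1 y.2.2) (monotone_comp_xOf hg _ _ _)
  dsimp only at tab
  simp_rw [D.lawN_cast w] at tab
  have hF1 : ∑ y : Bool × Bool × Bool, 10 ^ 30 * D.Z w *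
      ∑ α, ∑ γ, D.Φ w α γ * (X.cps 0 α y.1 * X.cps 1 α y.2.1 * X.cps 2 α y.2.2) =
      10 ^ 30 * D.Z w * ∑ α, ∑ γ, D.Φ w α γ := by
    rw [← Finset.mul_sum, Finset.sum_comm]
    congr 1
    refine Finset.sum_congr rfl fun α _ => ?_
    rw [Finset.sum_comm]
    refine Finset.sum_congr rfl fun γ _ => ?_
    rw [← Finset.mul_sum, X.sum_cps_prod α, mul_one]
  have hF2 : ∑ y : Bool × Bool × Bool, 10 ^ 30 * D.Z w *
      (∑ α, ∑ γ, D.Φ w α γ * (X.cps 0 α y.1 * X.cps 1 α y.2.1 * X.cps 2 α y.2.2)) * X.Gt g y.1 y.2.1 y.2.2 =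
      10 ^ 30 * D.Z w * ∑ α, ∑ γ, D.Φ w α γ *
        ∑ y0, ∑ y1, ∑ y2, X.cps 0 α y0 * X.cps 1 α y1 * X.cps 2 α y2 * X.Gt g y0 y1 y2 := by
    have e : ∀ y : Bool × Bool × Bool, 10 ^ 30 * D.Z w *
        (∑ α, ∑ γ, D.Φ w α γ * (X.cps 0 α y.1 * X.cps 1 α y.2.1 * X.cps 2 α y.2.2)) * X.Gt g y.1 y.2.1 y.2.2 =
        10 ^ 30 * D.Z w * ∑ α, ∑ γ, D.Φ w α γ *
          (X.cps 0 α y.1 * X.cps 1 α y.2.1 * X.cps 2 α y.2.2 * X.Gt g y.1 y.2.1 y.2.2) := by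
      intro y
      rw [mul_assoc, Finset.sum_mul]
      congr 1
      refine Finset.sum_congr rfl fun α _ => ?_
      rw [Finset.sum_mul]
      exact Finset.sum_congr rfl fun γ _ => by ring
    simp_rw [e]
    rw [← Finset.mul_sum, Finset.sum_comm]
    congr 1
    refine Finset.sum_congr rfl fun α _ => ?_
    rw [Finset.sum_comm]
    refine Finset.sum_congr rfl fun γ _ => ?_
    rw [← Finset.mul_sum, Fintype.sum_prod_type]
    congr 1
    refine Finset.sum_congr rfl fun y0 _ => ?_
    rw [Fintype.sum_prod_type]
  rw [hF1, hF2, mul_assoc] at tab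
  exact le_of_mul_le_mul_left tab (by have := D.Z_pos w; positivity)

end StepCtx

end VdBEMarkov

end Summit.CriticalPhenomena.PercolationContinuityZ3.Theorems.Pcint
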